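import Summits.QuantumAdvantage.QuantumAdvantage.Theorems.NearExactIsExact.Negative.CylinderSix
import Summits.QuantumAdvantage.QuantumAdvantage.Theorems.NearExactIsExact.Negative.ProductTestDegree
import Summits.QuantumAdvantage.QuantumAdvantage.Theorems.CubicForrelationNearExactIsExactAmmCeilingQ

/-!
# `NearExactIsExact` (stmt-QuantumAdvantage-14043) — negative side: **no cylinder residual over an isolated
6-flat of the frame** (disprover gen 38, DISPROOF §46; closes the gap left by `TriangularBqqFive` / `CylinderSix`)

Setting (BQ-habitat of the crux, b2b cell): `π, τ` mutually inverse coordinatewise-QUADRATIC maps of `𝔽₂^{k+5}`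
preserving the first `k` coordinates (frame `t ∈ 𝔽₂^k`, block `y ∈ 𝔽₂⁵`), `c₁, c₂` CUBIC, residual
`R = c₁ ⊕ c₂∘π`.  `TriangularBqqFive.bqq_triangular_five_or_cylinder` (gen 36) leaves exactly one alternative
open: the CYLINDER, every slice `R_t` empty or full.  `CylinderSix.frameAffine_residual_ne_flat` (THEOREM CYL6)
kills a cylinder `[u = 0] ⊗ 1` over a 6-bit frame PROVIDED the block maps are fibre-affine with affine sections.
Here we supply that proviso from the tree's product test and close the cylinder case over any affinely
parametrised 6-flat of the frame:

* `frame6_cylinder_false` — on `6 + 5` bits: a frame-preserving biquadratic configuration NEVER has the residual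
  `1_{u = 0}` (the full-slice cylinder over one frame point).  Proof: OBSERVATION B / normal form D2
  (`ProductTestDegree.isDegLeFun_comp_param` at `s = 11, m = 5`, test `(d₁,d₂) = (3,1)`, applied to `(π,τ)` AND to
  the swapped configuration `(τ,π)`) makes `τ(0‖·)` affine on the residual 5-flat; the base-point-free polar form of
  a quadratic (`acq_polar_shift`) upgrades this to "every fibre `τ(u‖·)` is affine"; hence the sections
  `y_k(u) = blockτ(u ‖ a(u) ⊕ e_k) = blockτ(u‖e_k) ⊕ blockτ(u‖0)` are derivatives of a quadratic, i.e. AFFINE in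
  `u`, and THEOREM CYL6 applies.
* `cylinder_window_false` — on `k + 5` bits, any `k`: for every map `φ : 𝔽₂⁶ → 𝔽₂^k` with affine coordinates
  the residual restricted to the flat `{(φ s ‖ y)}` is never `[s = 0]` (pull the configuration back along
  `(s,y) ↦ (φ s ‖ y)`; the pull-back is again frame-preserving biquadratic with cubic `c`'s).
  With `IsolatingFlat.exists_affine_isolating` (j = 6) this is the missing link that turns
  `bqq_triangular_five_or_cylinder` into BQQ in full for 5-bit blocks (assembly deferred until that module builds).

HONEST FRAMING: kernel-checked STRUCTURE THEOREMS on the negative side of the crux (one finite habitat of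
`NearExactIsExact`); no Theses statement is asserted or refuted; standard axioms; NOT summit progress.
References (orientation only): C. Carlet, *Boolean Functions for Cryptography and Coding Theory* (CUP 2021) §2.2,
§5.1 (derivatives, polar forms); MacWilliams–Sloane (1977) Ch. 13–15 (Reed–Muller duality).
-/

set_option linter.dupNamespace false -- D-0017: single-problem summit ⇒ `QuantumAdvantage.QuantumAdvantage` by design

namespace Summit.QuantumAdvantage.QuantumAdvantage.Theorems.NearExactIsExact.Negative.FrameSixCylinder

open Finset
open Literature.Computability.QuantumComplexity
open Literature.Computability.QuantumComplexity.BuzetChailloux (bxor zeroVec)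
open Summit.QuantumAdvantage.QuantumAdvantage.Theorems.CubicForrelation.NearExactIsExact
open Summit.QuantumAdvantage.QuantumAdvantage.Theorems.NearExactIsExact.Negative.SkewProductResidual
  (flatU dir flatU_append emb_coord_deg)
open Summit.QuantumAdvantage.QuantumAdvantage.Theorems.NearExactIsExact.Negative.CylinderSix
  (frameAffine_residual_ne_flat)
open Summit.QuantumAdvantage.QuantumAdvantage.Theorems.NearExactIsExact.Negative.ProductTestDegree
  (isDegLeFun_comp_param)

/-! ### Bit-vector bookkeeping on `𝔽₂⁶ × 𝔽₂⁵` -/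

/-- `(u‖0) ⊕ (0‖w) = (u‖w)`. [folklore] -/
theorem bxor_append_zero (u : Fin 6 → Bool) (w : Fin 5 → Bool) :
    bxor (Fin.append u (zeroVec : Fin 5 → Bool)) (Fin.append (zeroVec : Fin 6 → Bool) w) = Fin.append u w := by
  funext i
  induction i using Fin.addCases with
  | left i => simp [bxor, Fin.append_left, zeroVec]
  | right j => simp [bxor, Fin.append_right, zeroVec]

/-- `(0‖v) ⊕ (0‖v') = (0‖v⊕v')`. [folklore] -/
theorem bxor_zero_append (v v' : Fin 5 → Bool) :
    bxor (Fin.append (zeroVec : Fin 6 → Bool) v) (Fin.append (zeroVec : Fin 6 → Bool) v') =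
      Fin.append (zeroVec : Fin 6 → Bool) (bxor v v') := by
  funext i
  induction i using Fin.addCases with
  | left i => simp [bxor, Fin.append_left, zeroVec]
  | right j => simp [bxor, Fin.append_right]

/-- `0 = (0‖0)` in `𝔽₂^{6+5}`. [folklore] -/
theorem zeroVec_eq_append :
    (zeroVec : Fin (6 + 5) → Bool) = Fin.append (zeroVec : Fin 6 → Bool) (zeroVec : Fin 5 → Bool) := by
  funext i
  induction i using Fin.addCases with
  | left i => simp [Fin.append_left, zeroVec]
  | right j => simp [Fin.append_right, zeroVec]

/-- `(u‖0) ⊕ e_{6+k} = (u‖e_k)`. [folklore] -/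
theorem bxor_append_dir (u : Fin 6 → Bool) (k : Fin 5) :
    bxor (Fin.append u (zeroVec : Fin 5 → Bool)) (dir k) = Fin.append u (fun j => decide (j = k)) := by
  funext i
  induction i using Fin.addCases with
  | left i => simp [bxor, Fin.append_left, dir]
  | right j => simp [bxor, Fin.append_right, zeroVec, dir]

/-- The flat `U = {u = 0}` is the image of `w ↦ (0‖w)`. [folklore] -/
theorem flatU_iff (y : Fin (6 + 5) → Bool) :
    flatU y = true ↔ ∃ w : Fin 5 → Bool, Fin.append (zeroVec : Fin 6 → Bool) w = y := by
  rw [flatU, decide_eq_true_iff]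
  constructor
  · intro h
    refine ⟨fun j => y (Fin.natAdd 6 j), funext fun i => ?_⟩
    induction i using Fin.addCases with
    | left i => rw [Fin.append_left]; exact (h i).symm
    | right j => rw [Fin.append_right]
  · rintro ⟨w, rfl⟩ i
    rw [Fin.append_left]; rfl

/-! ### The 11-bit theorem -/

/-- **No cylinder over a 6-bit frame (s = 11).**  `π, τ` mutually inverse coordinatewise-quadratic maps of
`𝔽₂^{6+5}` preserving the 6 frame coordinates, `c₁, c₂` cubic: the residual `c₁ ⊕ c₂∘π` is NOT the
indicator of `U = {u = 0}`.  (D2 via the product test for `(π,τ)` and `(τ,π)`; polar form ⇒ fibre-affine `τ`;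
sections = derivatives of a quadratic ⇒ affine; then THEOREM CYL6.) [folklore] -/
theorem frame6_cylinder_false (π τ : (Fin (6 + 5) → Bool) → (Fin (6 + 5) → Bool))
    (hπ : ∀ i, IsDegLeFun 2 (fun z => π z i)) (hτ : ∀ i, IsDegLeFun 2 (fun z => τ z i))
    (hτπ : ∀ z, τ (π z) = z) (hπτ : ∀ z, π (τ z) = z)
    (hpres : ∀ z (i : Fin 6), π z (Fin.castAdd 5 i) = z (Fin.castAdd 5 i))
    (c₁ c₂ : (Fin (6 + 5) → Bool) → Bool) (h₁ : IsDegLeFun 3 c₁) (h₂ : IsDegLeFun 3 c₂) :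
    ¬ ∀ z, (c₁ z ^^ c₂ (π z)) = flatU z := by
  intro hres
  -- τ preserves the frame as well
  have hτpres : ∀ z (i : Fin 6), τ z (Fin.castAdd 5 i) = z (Fin.castAdd 5 i) := fun z i => by
    have h := hpres (τ z) i
    rw [hπτ] at h
    exact h.symm
  -- the residual flat `U = (0‖𝔽₂⁵)`, parametrised by `w ↦ (0‖w)` with retraction `y ↦ block y`
  have hρ : ∀ j : Fin 5, IsDegLeFun 1 (fun y : Fin (6 + 5) → Bool => y (Fin.natAdd 6 j)) :=
    fun j => isDegLeFun_apply _ le_rfl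
  have hρe : ∀ w : Fin 5 → Bool,
      (fun j => Fin.append (zeroVec : Fin 6 → Bool) w (Fin.natAdd 6 j)) = w :=
    fun w => funext fun j => Fin.append_right _ _ j
  -- the swapped configuration `(τ, π, c₂, c₁)` has the same residual
  have hres' : ∀ y, (c₂ y ^^ c₁ (τ y)) = flatU y := by
    intro y
    have h := hres (τ y)
    rw [hπτ] at h
    have hf : flatU (τ y) = flatU y := by simp only [flatU, hτpres]
    rw [hf] at h
    rw [← h]
    exact Bool.xor_comm _ _
  -- D2 for τ: the block of `τ(0‖w)` is affine in `w`
  have hDτ : ∀ j : Fin 5,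
      IsDegLeFun 1 (fun w : Fin 5 → Bool => τ (Fin.append (zeroVec : Fin 6 → Bool) w) (Fin.natAdd 6 j)) :=
    fun j => isDegLeFun_comp_param (d₁ := 3) (d₂ := 1) (k := 1) (by norm_num) (by norm_num) (by norm_num)
      τ π hτ hπ hπτ hτπ c₂ c₁ h₂ h₁ (fun w => Fin.append (zeroVec : Fin 6 → Bool) w)
      (fun y j => y (Fin.natAdd 6 j)) hρ hρe flatU flatU_iff hres' (fun y => y (Fin.natAdd 6 j)) (hρ j)
  -- fibre-affinity of `τ`: the second block-difference vanishes on every fibre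
  have bool4 : ∀ a b c : Bool, (a ^^ b ^^ c ^^ (b ^^ c ^^ a)) = false := by decide
  have key4 : ∀ (j : Fin 5) (u : Fin 6 → Bool) (v v' : Fin 5 → Bool),
      (τ (Fin.append u (zeroVec : Fin 5 → Bool)) (Fin.natAdd 6 j) ^^ τ (Fin.append u v) (Fin.natAdd 6 j) ^^
        τ (Fin.append u v') (Fin.natAdd 6 j) ^^ τ (Fin.append u (bxor v v')) (Fin.natAdd 6 j)) = false := by
    intro j u v v'
    have hp := acq_polar_shift (c := fun z => τ z (Fin.natAdd 6 j)) (hτ _)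
      (Fin.append u (zeroVec : Fin 5 → Bool)) (Fin.append (zeroVec : Fin 6 → Bool) v)
      (Fin.append (zeroVec : Fin 6 → Bool) v')
    simp only [bxor_zero_append, bxor_append_zero, zeroVec_eq_append] at hp
    have ha := acq_affine_of_deg_one (hDτ j) v v'
    rw [hp, ha]
    exact bool4 _ _ _
  -- the data of THEOREM CYL6: `a(u) = blockπ(u‖0)`, sections `y_k(u) = blockτ(u ‖ a(u) ⊕ e_k)`
  have ha : ∀ k : Fin 5, IsDegLeFun 2 (fun u : Fin 6 → Bool =>
      π (Fin.append u (zeroVec : Fin 5 → Bool)) (Fin.natAdd 6 k)) :=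
    fun k => fc_isDegLeFun_comp (hπ (Fin.natAdd 6 k)) (fun u => Fin.append u (zeroVec : Fin 5 → Bool))
      (emb_coord_deg 5) (by norm_num)
  -- `(u ‖ a(u)) = π(u‖0)`, so `τ(u ‖ a(u)) = (u‖0)`
  have hua : ∀ u : Fin 6 → Bool,
      Fin.append u (fun i => π (Fin.append u (zeroVec : Fin 5 → Bool)) (Fin.natAdd 6 i)) =
        π (Fin.append u (zeroVec : Fin 5 → Bool)) := by
    intro u; funext i
    induction i using Fin.addCases with
    | left i => rw [Fin.append_left, hpres, Fin.append_left]
    | right j => rw [Fin.append_right]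
  have hsec_eq : ∀ (k : Fin 5) (u : Fin 6 → Bool) (j : Fin 5),
      τ (Fin.append u (bxor (fun i => decide (i = k))
        (fun i => π (Fin.append u (zeroVec : Fin 5 → Bool)) (Fin.natAdd 6 i)))) (Fin.natAdd 6 j) =
      (τ (Fin.append u (zeroVec : Fin 5 → Bool)) (Fin.natAdd 6 j) ^^
        τ (bxor (Fin.append u (zeroVec : Fin 5 → Bool)) (dir k)) (Fin.natAdd 6 j)) := by
    intro k u j
    have h4 := key4 j u (fun i => decide (i = k))
      (fun i => π (Fin.append u (zeroVec : Fin 5 → Bool)) (Fin.natAdd 6 i))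
    have hz : τ (Fin.append u (fun i => π (Fin.append u (zeroVec : Fin 5 → Bool)) (Fin.natAdd 6 i)))
        (Fin.natAdd 6 j) = false := by
      rw [hua, hτπ, Fin.append_right]; rfl
    have bool_sec : ∀ A B C D : Bool, (A ^^ B ^^ C ^^ D) = false → C = false → D = (A ^^ B) := by decide
    rw [bxor_append_dir]
    exact bool_sec _ _ _ _ h4 hz
  have hyk : ∀ (k j : Fin 5), IsDegLeFun 1 (fun u : Fin 6 → Bool =>
      τ (Fin.append u (bxor (fun i => decide (i = k))
        (fun i => π (Fin.append u (zeroVec : Fin 5 → Bool)) (Fin.natAdd 6 i)))) (Fin.natAdd 6 j)) := by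
    intro k j
    have e : (fun u : Fin 6 → Bool => τ (Fin.append u (bxor (fun i => decide (i = k))
        (fun i => π (Fin.append u (zeroVec : Fin 5 → Bool)) (Fin.natAdd 6 i)))) (Fin.natAdd 6 j)) =
        fun u => (τ (Fin.append u (zeroVec : Fin 5 → Bool)) (Fin.natAdd 6 j) ^^
          τ (bxor (Fin.append u (zeroVec : Fin 5 → Bool)) (dir k)) (Fin.natAdd 6 j)) :=
      funext fun u => hsec_eq k u j
    rw [e]
    exact fc_isDegLeFun_comp (stub_derivDegree (6 + 5) 1 (fun z => τ z (Fin.natAdd 6 j)) (dir k) (hτ _))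
      (fun u => Fin.append u (zeroVec : Fin 5 → Bool)) (emb_coord_deg 5) (by norm_num)
  have hPyk : ∀ (k : Fin 5) (u : Fin 6 → Bool),
      (fun j => π (Fin.append u (fun j' => τ (Fin.append u (bxor (fun i => decide (i = k))
        (fun i => π (Fin.append u (zeroVec : Fin 5 → Bool)) (Fin.natAdd 6 i)))) (Fin.natAdd 6 j')))
        (Fin.natAdd 6 j)) =
      fun j => (decide (j = k) ^^ π (Fin.append u (zeroVec : Fin 5 → Bool)) (Fin.natAdd 6 j)) := by
    intro k u
    have e1 : Fin.append u (fun j' => τ (Fin.append u (bxor (fun i => decide (i = k))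
        (fun i => π (Fin.append u (zeroVec : Fin 5 → Bool)) (Fin.natAdd 6 i)))) (Fin.natAdd 6 j')) =
        τ (Fin.append u (bxor (fun i => decide (i = k))
          (fun i => π (Fin.append u (zeroVec : Fin 5 → Bool)) (Fin.natAdd 6 i)))) := by
      funext i
      induction i using Fin.addCases with
      | left i => rw [Fin.append_left, hτpres, Fin.append_left]
      | right j => rw [Fin.append_right]
    funext j
    rw [e1, hπτ, Fin.append_right]
  -- THEOREM CYL6
  refine frameAffine_residual_ne_flat (r := 5)
    (fun u w j => π (Fin.append u w) (Fin.natAdd 6 j))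
    (fun k u => π (Fin.append u (zeroVec : Fin 5 → Bool)) (Fin.natAdd 6 k)) ha (fun u => rfl)
    (fun k u j' => τ (Fin.append u (bxor (fun i => decide (i = k))
      (fun i => π (Fin.append u (zeroVec : Fin 5 → Bool)) (Fin.natAdd 6 i)))) (Fin.natAdd 6 j'))
    hyk hPyk c₁ c₂ h₁ h₂ (fun u w => ?_)
  have e2 : Fin.append u (fun j => π (Fin.append u w) (Fin.natAdd 6 j)) = π (Fin.append u w) := by
    funext i
    induction i using Fin.addCases with
    | left i => rw [Fin.append_left, hpres, Fin.append_left]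
    | right j => rw [Fin.append_right]
  rw [e2, hres, flatU_append]

/-! ### Any frame size: restriction to an affinely parametrised 6-flat of the frame -/

variable {k : ℕ}

/-- **No isolated cylinder window (all `k`).**  `π, τ` mutually inverse coordinatewise-quadratic maps of
`𝔽₂^{k+5}` with `π` preserving the first `k` coordinates, `c₁, c₂` cubic, `φ : 𝔽₂⁶ → 𝔽₂^k` with affine
coordinates (possibly degenerate).  Then it is NOT the case that the residual on the slices `φ s` is full at
`s = 0` and empty at every `s ≠ 0`:  `¬ ∀ s y, R(φ s ‖ y) = [s = 0]`.  (Pull back along `(s,y) ↦ (φ s ‖ y)` and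
apply `frame6_cylinder_false`.)  Combined with `exists_affine_isolating` (j = 6) this excludes the cylinder
alternative of `bqq_triangular_five_or_cylinder` whenever `64·|N| < 2^{k+1}`. [folklore] -/
theorem cylinder_window_false (π τ : (Fin (k + 5) → Bool) → (Fin (k + 5) → Bool))
    (hπ : ∀ i, IsDegLeFun 2 (fun z => π z i)) (hτ : ∀ i, IsDegLeFun 2 (fun z => τ z i))
    (hτπ : ∀ z, τ (π z) = z) (hpres : ∀ z (i : Fin k), π z (Fin.castAdd 5 i) = z (Fin.castAdd 5 i))
    (c₁ c₂ : (Fin (k + 5) → Bool) → Bool) (h₁ : IsDegLeFun 3 c₁) (h₂ : IsDegLeFun 3 c₂)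
    (φ : (Fin 6 → Bool) → (Fin k → Bool)) (hφ : ∀ x, IsDegLeFun 1 (fun s => φ s x)) :
    ¬ ∀ (s : Fin 6 → Bool) (y : Fin 5 → Bool),
      (c₁ (Fin.append (φ s) y) ^^ c₂ (π (Fin.append (φ s) y))) = decide (∀ i, s i = false) := by
  intro hcyl
  -- `π ∘ τ = id` (finite set) and `τ` preserves the frame
  have hinj : Function.Injective π := Function.LeftInverse.injective hτπ
  have hπτ : ∀ x, π (τ x) = x := by
    intro x
    obtain ⟨y, rfl⟩ := (Finite.injective_iff_surjective.1 hinj) x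
    rw [hτπ]
  have hτpres : ∀ z (i : Fin k), τ z (Fin.castAdd 5 i) = z (Fin.castAdd 5 i) := fun z i => by
    have h := hpres (τ z) i
    rw [hπτ] at h
    exact h.symm
  -- the pull-back map `ψ(s‖y) = (φ s ‖ y)` has affine coordinates
  have hψ : ∀ x : Fin (k + 5), IsDegLeFun 1 (fun z : Fin (6 + 5) → Bool =>
      Fin.append (φ (fun i => z (Fin.castAdd 5 i))) (fun j => z (Fin.natAdd 6 j)) x) := by
    intro x
    induction x using Fin.addCases with
    | left i =>
      have e : (fun z : Fin (6 + 5) → Bool =>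
          Fin.append (φ (fun i => z (Fin.castAdd 5 i))) (fun j => z (Fin.natAdd 6 j)) (Fin.castAdd 5 i)) =
          fun z => φ (fun i' => z (Fin.castAdd 5 i')) i := funext fun z => Fin.append_left _ _ i
      rw [e]
      exact fc_isDegLeFun_comp (hφ i) (fun (z : Fin (6 + 5) → Bool) (i' : Fin 6) => z (Fin.castAdd 5 i'))
        (fun i' => isDegLeFun_apply _ le_rfl) (by norm_num)
    | right j =>
      have e : (fun z : Fin (6 + 5) → Bool =>
          Fin.append (φ (fun i => z (Fin.castAdd 5 i))) (fun j => z (Fin.natAdd 6 j)) (Fin.natAdd k j)) =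
          fun z => z (Fin.natAdd 6 j) := funext fun z => Fin.append_right _ _ j
      rw [e]
      exact isDegLeFun_apply _ le_rfl
  -- frame parts are preserved by the pulled-back maps
  have hπψ : ∀ z : Fin (6 + 5) → Bool,
      π (Fin.append (φ (fun i => z (Fin.castAdd 5 i))) (fun j => z (Fin.natAdd 6 j))) =
        Fin.append (φ (fun i => z (Fin.castAdd 5 i)))
          (fun j => π (Fin.append (φ (fun i => z (Fin.castAdd 5 i))) (fun j => z (Fin.natAdd 6 j)))
            (Fin.natAdd k j)) := by
    intro z; funext x
    induction x using Fin.addCases with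
    | left i => rw [hpres, Fin.append_left, Fin.append_left]
    | right j => rw [Fin.append_right]
  have hτψ : ∀ z : Fin (6 + 5) → Bool,
      τ (Fin.append (φ (fun i => z (Fin.castAdd 5 i))) (fun j => z (Fin.natAdd 6 j))) =
        Fin.append (φ (fun i => z (Fin.castAdd 5 i)))
          (fun j => τ (Fin.append (φ (fun i => z (Fin.castAdd 5 i))) (fun j => z (Fin.natAdd 6 j)))
            (Fin.natAdd k j)) := by
    intro z; funext x
    induction x using Fin.addCases with
    | left i => rw [hτpres, Fin.append_left, Fin.append_left]
    | right j => rw [Fin.append_right]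
  -- the pulled-back configuration on `6 + 5` bits
  refine frame6_cylinder_false
    (fun z => Fin.append (fun i => z (Fin.castAdd 5 i))
      (fun j => π (Fin.append (φ (fun i => z (Fin.castAdd 5 i))) (fun j => z (Fin.natAdd 6 j))) (Fin.natAdd k j)))
    (fun z => Fin.append (fun i => z (Fin.castAdd 5 i))
      (fun j => τ (Fin.append (φ (fun i => z (Fin.castAdd 5 i))) (fun j => z (Fin.natAdd 6 j))) (Fin.natAdd k j)))
    ?_ ?_ ?_ ?_ ?_
    (fun z => c₁ (Fin.append (φ (fun i => z (Fin.castAdd 5 i))) (fun j => z (Fin.natAdd 6 j))))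
    (fun z => c₂ (Fin.append (φ (fun i => z (Fin.castAdd 5 i))) (fun j => z (Fin.natAdd 6 j))))
    (fc_isDegLeFun_comp h₁ _ hψ (by norm_num)) (fc_isDegLeFun_comp h₂ _ hψ (by norm_num)) ?_
  · -- π₁ coordinatewise quadratic
    intro x
    induction x using Fin.addCases with
    | left i =>
      have e : (fun z : Fin (6 + 5) → Bool => Fin.append (fun i => z (Fin.castAdd 5 i))
          (fun j => π (Fin.append (φ (fun i => z (Fin.castAdd 5 i))) (fun j => z (Fin.natAdd 6 j)))
            (Fin.natAdd k j)) (Fin.castAdd 5 i)) = fun z => z (Fin.castAdd 5 i) :=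
        funext fun z => Fin.append_left _ _ i
      rw [e]
      exact isDegLeFun_apply _ (by norm_num)
    | right j =>
      have e : (fun z : Fin (6 + 5) → Bool => Fin.append (fun i => z (Fin.castAdd 5 i))
          (fun j => π (Fin.append (φ (fun i => z (Fin.castAdd 5 i))) (fun j => z (Fin.natAdd 6 j)))
            (Fin.natAdd k j)) (Fin.natAdd 6 j)) =
          fun z => π (Fin.append (φ (fun i => z (Fin.castAdd 5 i))) (fun j => z (Fin.natAdd 6 j)))
            (Fin.natAdd k j) := funext fun z => Fin.append_right _ _ j
      rw [e]
      exact fc_isDegLeFun_comp (hπ _) _ hψ (by norm_num)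
  · -- τ₁ coordinatewise quadratic
    intro x
    induction x using Fin.addCases with
    | left i =>
      have e : (fun z : Fin (6 + 5) → Bool => Fin.append (fun i => z (Fin.castAdd 5 i))
          (fun j => τ (Fin.append (φ (fun i => z (Fin.castAdd 5 i))) (fun j => z (Fin.natAdd 6 j)))
            (Fin.natAdd k j)) (Fin.castAdd 5 i)) = fun z => z (Fin.castAdd 5 i) :=
        funext fun z => Fin.append_left _ _ i
      rw [e]
      exact isDegLeFun_apply _ (by norm_num)
    | right j =>
      have e : (fun z : Fin (6 + 5) → Bool => Fin.append (fun i => z (Fin.castAdd 5 i))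
          (fun j => τ (Fin.append (φ (fun i => z (Fin.castAdd 5 i))) (fun j => z (Fin.natAdd 6 j)))
            (Fin.natAdd k j)) (Fin.natAdd 6 j)) =
          fun z => τ (Fin.append (φ (fun i => z (Fin.castAdd 5 i))) (fun j => z (Fin.natAdd 6 j)))
            (Fin.natAdd k j) := funext fun z => Fin.append_right _ _ j
      rw [e]
      exact fc_isDegLeFun_comp (hτ _) _ hψ (by norm_num)
  · -- τ₁ ∘ π₁ = id
    intro z
    have hfr : (fun i => Fin.append (fun i => z (Fin.castAdd 5 i))
        (fun j => π (Fin.append (φ (fun i => z (Fin.castAdd 5 i))) (fun j => z (Fin.natAdd 6 j)))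
          (Fin.natAdd k j)) (Fin.castAdd 5 i)) = fun i => z (Fin.castAdd 5 i) :=
      funext fun i => Fin.append_left _ _ i
    have hbl : (fun j => Fin.append (fun i => z (Fin.castAdd 5 i))
        (fun j => π (Fin.append (φ (fun i => z (Fin.castAdd 5 i))) (fun j => z (Fin.natAdd 6 j)))
          (Fin.natAdd k j)) (Fin.natAdd 6 j)) =
        fun j => π (Fin.append (φ (fun i => z (Fin.castAdd 5 i))) (fun j => z (Fin.natAdd 6 j)))
          (Fin.natAdd k j) := funext fun j => Fin.append_right _ _ j
    simp only [hfr, hbl]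
    funext x
    induction x using Fin.addCases with
    | left i => rw [Fin.append_left]
    | right j => rw [Fin.append_right, ← hπψ, hτπ, Fin.append_right]
  · -- π₁ ∘ τ₁ = id
    intro z
    have hfr : (fun i => Fin.append (fun i => z (Fin.castAdd 5 i))
        (fun j => τ (Fin.append (φ (fun i => z (Fin.castAdd 5 i))) (fun j => z (Fin.natAdd 6 j)))
          (Fin.natAdd k j)) (Fin.castAdd 5 i)) = fun i => z (Fin.castAdd 5 i) :=
      funext fun i => Fin.append_left _ _ i
    have hbl : (fun j => Fin.append (fun i => z (Fin.castAdd 5 i))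
        (fun j => τ (Fin.append (φ (fun i => z (Fin.castAdd 5 i))) (fun j => z (Fin.natAdd 6 j)))
          (Fin.natAdd k j)) (Fin.natAdd 6 j)) =
        fun j => τ (Fin.append (φ (fun i => z (Fin.castAdd 5 i))) (fun j => z (Fin.natAdd 6 j)))
          (Fin.natAdd k j) := funext fun j => Fin.append_right _ _ j
    simp only [hfr, hbl]
    funext x
    induction x using Fin.addCases with
    | left i => rw [Fin.append_left]
    | right j => rw [Fin.append_right, ← hτψ, hπτ, Fin.append_right]
  · -- π₁ preserves the frame
    intro z i
    exact Fin.append_left _ _ i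
  · -- the pulled-back residual is `1_{s = 0}`
    intro z
    have hfr : (fun i => Fin.append (fun i => z (Fin.castAdd 5 i))
        (fun j => π (Fin.append (φ (fun i => z (Fin.castAdd 5 i))) (fun j => z (Fin.natAdd 6 j)))
          (Fin.natAdd k j)) (Fin.castAdd 5 i)) = fun i => z (Fin.castAdd 5 i) :=
      funext fun i => Fin.append_left _ _ i
    have hbl : (fun j => Fin.append (fun i => z (Fin.castAdd 5 i))
        (fun j => π (Fin.append (φ (fun i => z (Fin.castAdd 5 i))) (fun j => z (Fin.natAdd 6 j)))
          (Fin.natAdd k j)) (Fin.natAdd 6 j)) =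
        fun j => π (Fin.append (φ (fun i => z (Fin.castAdd 5 i))) (fun j => z (Fin.natAdd 6 j)))
          (Fin.natAdd k j) := funext fun j => Fin.append_right _ _ j
    simp only [hfr, hbl]
    rw [← hπψ, hcyl]
    rfl

end Summit.QuantumAdvantage.QuantumAdvantage.Theorems.NearExactIsExact.Negative.FrameSixCylinder
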